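import Mathlib

/-!
Sketch for crux idea `honest-side-inward` (crux stmt-QuantumFields-11512, crux-strategist 2026-08-17): first-lemma signatures.
-/

namespace Summit.QuantumFields.QCD.Cruxes.FMClosureUnquenched.HonestSideInward

open MeasureTheory

/-- **Prefactor-free spectral support (first lemma).** For a finite positive measure `ρ` carried by `[0,1]` (the spectral measure of
`ÂΩ` under Lüscher's positive transfer matrix) whose moments `c(n) = ∫ λⁿ dρ` decay like `C e^{-μ n}` with ANY prefactor `C`, the
measure charges nothing above `e^{-μ}`: the RATE alone fixes the spectral support.  (So a clause (ii) / flavour-decay bound with a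
k-DEPENDENT prefactor `C_k = a_k^{-p}` still yields the lattice gap `σ(𝕋) ∩ (e^{-a_kΔ}, 1) = ∅`, after which correlations are bounded
with the k-UNIFORM constant `‖Â‖‖B̂‖`.) -/
def SpectralSupportOfRate : Prop :=
  ∀ (ρ : Measure ℝ) [IsFiniteMeasure ρ], (∀ᵐ x ∂ρ, 0 ≤ x ∧ x ≤ 1) →
    ∀ (C μ : ℝ), 0 < μ → (∀ n : ℕ, ∫ x, x ^ n ∂ρ ≤ C * Real.exp (-(μ * n))) →
      ρ (Set.Ioc (Real.exp (-μ)) 1) = 0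

/-- **Uniform bound from spectral support (second lemma).** Conversely, once `ρ` is carried by `[0, e^{-μ}]`, every moment obeys the
bound with the prefactor `ρ(univ)` (= `‖ÂΩ‖²`-type, k-uniform for bounded lattice operators). -/
def UniformBoundOfSupport : Prop :=
  ∀ (ρ : Measure ℝ) [IsFiniteMeasure ρ] (μ : ℝ), 0 < μ → (∀ᵐ x ∂ρ, 0 ≤ x ∧ x ≤ Real.exp (-μ)) →
    ∀ n : ℕ, ∫ x, x ^ n ∂ρ ≤ (ρ Set.univ).toReal * Real.exp (-(μ * n))

/-- **Window arithmetic (STRATEGY-CENSUS S2).** A k-uniform lattice power law inside the log window implies physical-rate decay with a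
k-uniform constant there: if `E(n) ≤ A (1+n)^{-η}` for `a n ≤ K (1 + |log a|)` then `E(n) ≤ A e^{-δ a n}` on the same window as soon as
`δ < η / K` and `a` is small — because `n ↦ (1+n)^{-η} e^{δ a n}` is decreasing then increasing, so its sup on the window is attained at an
endpoint. Stated for one spacing `a ∈ (0, a₀]`. -/
def PowerLawWindow : Prop :=
  ∀ (η K δ : ℝ), 0 < η → 0 < K → 0 < δ → δ * K < η → ∃ a₀ : ℝ, 0 < a₀ ∧ ∀ a : ℝ, 0 < a → a ≤ a₀ →
    ∀ n : ℕ, a * n ≤ K * (1 + |Real.log a|) → (1 + (n : ℝ)) ^ (-η) * Real.exp (δ * (a * n)) ≤ 1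

end Summit.QuantumFields.QCD.Cruxes.FMClosureUnquenched.HonestSideInward
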